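import Mathlib
import HarnessLib
import Summits.AtomisticToContinuum.BoseEinsteinCondensation.Theorems.BECConjugateDominationInfraredMinimumUncertaintyFSum

/-!
# Route `BECConjugateDomination` — crux `InfraredMinimumUncertainty` (stmt-AtomisticToContinuum-11784),
# line `fisher-gaussian-density-mode`, stub `stub_steinIdentity`

The Stein / by-parts form of the commutator pairing of the lifted Fisher functional
(units `ħ = 2m = 1`). For a real-valued (`Ψ = |Ψ|`) periodic `C¹` state on the `N = n+1`-particle
torus of side `L`, a mode `m ∈ ℤ³` with wave vector `k = (2π/L)·m` (`waveVec`), plane waves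
`eⱼ = e^{ik·xⱼ}` (`cellWave L m (X j)`), density mode `Z = ∑ⱼ eⱼ` (`densityMode`), second harmonic
`Z⁽²⁾ = ∑ⱼ eⱼ²`, commutator amplitude `W = ∑ⱼ eⱼ (‖k‖²Ψ − 2i ∂_{xⱼ·k}Ψ)` (`commutatorAmp`) and a
real-`C¹` test field `φ : ℂ → ℂ` with Wirtinger derivatives `∂φ = (Dφ·1 − i Dφ·i)/2`,
`∂̄φ = (Dφ·1 + i Dφ·i)/2`:

  `Re ∫_{cell^N} φ̄(Z) W Ψ̄ dX = ‖k‖² · Re ∫_{cell^N} (N ∂φ(Z) − ∂̄φ(Z) Z̄⁽²⁾) |Ψ|² dX`.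

Proof (periodic integration by parts along the density wave `Pi.single j k`, particle by particle).
With `u = Re Ψ = |Ψ|`, `Re(φ̄(Z) W u) = ∑ⱼ (‖k‖² u² Re(φ̄(Z)eⱼ) + 2u ∂ⱼu · Im(φ̄(Z)eⱼ))`; the flux
`u² Im(φ̄(Z)eⱼ)` is `C¹` and lattice periodic, so its `∂ⱼ` integrates to `0`, and
`∂ⱼ Im(φ̄(Z)eⱼ) = ‖k‖² (Re(φ̄(Z)eⱼ) − Re ∂φ(Z) + Re(∂̄φ(Z) ēⱼ²))` by `∂ⱼ e_l = δⱼₗ i‖k‖² e_l`, the real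
chain rule and the Wirtinger decomposition `Dφ(z)·w = ∂φ(z) w + ∂̄φ(z) w̄` (`|eⱼ| = 1`); summing over
`j` the `Re(φ̄(Z)eⱼ)` terms cancel. The torus calculus (`fderiv_cellWave_comp_apply_waveVec`,
`fderiv_densityMode_waveVec`, `integral_cellN_fderiv_single_eq_zero`, periodicity) is the landed
f-sum file `…InfraredMinimumUncertaintyFSum.lean` (imported, not restated); the new ingredient is
`clm_apply_eq_wirtinger` / `fderiv_steinPhase_waveVec`. The registered signature (inline `k`, `Z`,
`W`) is `steinIdentity_holds` by `rfl`-unfolding of `waveVec` / `densityMode` / `commutatorAmp`.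
No `m ≠ 0` hypothesis is needed. All `[folklore]`.
-/

noncomputable section

open MeasureTheory Filter Set Complex
open scoped ENNReal NNReal Topology ComplexConjugate BigOperators

namespace Summit.AtomisticToContinuum.BoseEinsteinCondensation.Theorems

open Literature.MathematicalPhysics.QuantumManyBody.BoseGas
open Summit.AtomisticToContinuum.BoseEinsteinCondensation.Cruxes.InfraredMinimumUncertainty.FisherGaussianDensityMode

namespace ImuSteinIdentity

variable {N : ℕ}

/-! ## The Wirtinger decomposition and the derivative of the Stein phase `Im(φ̄(Z) e_j)` -/

/-- **Wirtinger decomposition** of a real-linear map `T : ℂ →L[ℝ] ℂ`: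
`T w = ∂T · w + ∂̄T · w̄` with `∂T = (T 1 − i T i)/2`, `∂̄T = (T 1 + i T i)/2`. [folklore] -/
theorem clm_apply_eq_wirtinger (T : ℂ →L[ℝ] ℂ) (w : ℂ) :
    T w = (T 1 - I * T I) / 2 * w + (T 1 + I * T I) / 2 * conj w := by
  have hw : w = (w.re : ℝ) • (1 : ℂ) + (w.im : ℝ) • I := by
    rw [real_smul, real_smul, mul_one]
    exact (re_add_im w).symm
  rw [hw, map_add, map_smul, map_smul]
  simp only [real_smul, map_add, map_mul, conj_ofReal, conj_I, mul_one]
  linear_combination ((w.im : ℂ) * T I) * I_sq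

/-- Complex algebra of the derivative of the Stein phase:
`Im(P̄ (iκe) + e · conj(D (iκe) + D' conj(iκe))) = κ (Re(P̄ e) − Re D + Re(D' ē²))` for `|e| = 1`.
[folklore] -/
theorem im_stein_algebra (P D D' e : ℂ) (κ : ℝ) (he : ‖e‖ = 1) :
    (conj P * (I * κ * e) + e * conj (D * (I * κ * e) + D' * conj (I * κ * e))).im =
      κ * ((conj P * e).re - D.re + (D' * conj (e ^ 2)).re) := by
  have ht : e * conj e = 1 := by
    rw [mul_comm, ← normSq_eq_conj_mul_self, normSq_eq_norm_sq, he]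
    simp
  have key : conj P * (I * κ * e) + e * conj (D * (I * κ * e) + D' * conj (I * κ * e)) =
      I * κ * (conj P * e - conj D + conj D' * e ^ 2) := by
    simp only [map_add, map_mul, map_neg, conj_conj, conj_I, conj_ofReal]
    linear_combination (-(I * κ * conj D)) * ht
  rw [key]
  simp only [mul_im, mul_re, sub_re, sub_im, add_re, add_im, I_re, I_im, ofReal_re, ofReal_im,
    conj_re, conj_im]
  ring

/-- The Stein phase `F_j = Im(φ̄(Z) e_j)` is `C¹` for a `C¹` field `φ`. [folklore] -/
theorem contDiff_steinPhase (L : ℝ) (m : Fin 3 → ℤ) {φ : ℂ → ℂ} (hφ : ContDiff ℝ 1 φ) (j : Fin N) :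
    ContDiff ℝ 1 (fun Y : Config N => (conj (φ (densityMode N L m Y)) * cellWave L m (Y j)).im) := by
  have h₀ := (conjCLE.contDiff.comp (hφ.comp (contDiff_densityMode N L m))).mul
    (contDiff_cellWave_comp_apply L m j)
  exact imCLM.contDiff.comp h₀

/-- **Derivative of the Stein phase along the density wave** (real chain rule + Wirtinger
decomposition, `∂_{x_j·k} e_j = i‖k‖² e_j`, `∂_{x_j·k} Z = i‖k‖² e_j`, `|e_j| = 1`):
`∂_{x_j·k} Im(φ̄(Z) e_j) = ‖k‖² (Re(φ̄(Z) e_j) − Re ∂φ(Z) + Re(∂̄φ(Z) ē_j²))`. [folklore] -/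
theorem fderiv_steinPhase_waveVec (L : ℝ) (m : Fin 3 → ℤ) {φ : ℂ → ℂ} (hφ : ContDiff ℝ 1 φ)
    (j : Fin N) (X : Config N) :
    fderiv ℝ (fun Y : Config N => (conj (φ (densityMode N L m Y)) * cellWave L m (Y j)).im) X
        (Pi.single j (waveVec L m)) =
      ‖waveVec L m‖ ^ 2 * ((conj (φ (densityMode N L m X)) * cellWave L m (X j)).re -
        ((fderiv ℝ φ (densityMode N L m X) 1 - I * fderiv ℝ φ (densityMode N L m X) I) / 2).re +
        ((fderiv ℝ φ (densityMode N L m X) 1 + I * fderiv ℝ φ (densityMode N L m X) I) / 2 *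
          conj (cellWave L m (X j) ^ 2)).re) := by
  have hZ : HasFDerivAt (densityMode N L m) (fderiv ℝ (densityMode N L m) X) X :=
    ((contDiff_densityMode N L m).differentiable one_ne_zero X).hasFDerivAt
  have hφZc : HasFDerivAt (fun Y => star (φ (densityMode N L m Y)))
      (((starL' ℝ : ℂ ≃L[ℝ] ℂ) : ℂ →L[ℝ] ℂ).comp
        ((fderiv ℝ φ (densityMode N L m X)).comp (fderiv ℝ (densityMode N L m) X))) X :=
    ((((hφ.differentiable one_ne_zero) _).hasFDerivAt).comp X hZ).star
  have hF : HasFDerivAt (fun Y : Config N => (conj (φ (densityMode N L m Y)) * cellWave L m (Y j)).im)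
      (imCLM.comp (star (φ (densityMode N L m X)) •
          fderiv ℝ (fun Y : Config N => cellWave L m (Y j)) X +
        cellWave L m (X j) • ((starL' ℝ : ℂ ≃L[ℝ] ℂ) : ℂ →L[ℝ] ℂ).comp
          ((fderiv ℝ φ (densityMode N L m X)).comp (fderiv ℝ (densityMode N L m) X)))) X :=
    imCLM.hasFDerivAt.comp X
      (hφZc.mul (differentiableAt_cellWave_comp_apply L m j X).hasFDerivAt)
  rw [hF.fderiv]
  simp only [ContinuousLinearMap.comp_apply, FunLike.coe_add, Pi.add_apply,
    FunLike.coe_smul, Pi.smul_apply, ContinuousLinearEquiv.coe_coe, starL'_apply,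
    star_def, smul_eq_mul, imCLM_apply]
  rw [fderiv_cellWave_comp_apply_waveVec, fderiv_densityMode_waveVec, if_pos rfl,
    clm_apply_eq_wirtinger (fderiv ℝ φ _) (I * _ * _)]
  exact im_stein_algebra _ _ _ _ _ (norm_cellWave L m (X j))

/-! ## Step B: per-particle integration by parts -/

/-- Complex algebra of one summand of `Re(φ̄(Z) W ū)` for a real amplitude:
`Re(P (e (κu − 2iu')) u) = κ u² Re(Pe) + 2 u u' Im(Pe)`. [folklore] -/
theorem re_stein_summand (P e : ℂ) (κ u u' : ℝ) :
    (P * (e * (((κ : ℝ) : ℂ) * ((u : ℝ) : ℂ) - 2 * I * ((u' : ℝ) : ℂ))) * ((u : ℝ) : ℂ)).re =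
      κ * (u ^ 2 * (P * e).re) + 2 * u * u' * (P * e).im := by
  simp only [mul_re, mul_im, sub_re, sub_im, ofReal_re, ofReal_im, I_re, I_im, re_ofNat, im_ofNat]
  ring

/-- **Step B** (per particle, periodic integration by parts along the density wave):
`∫ 2 u ∂_{x_j·k}u · Im(φ̄(Z) e_j) = ‖k‖² ∫ u² (Re ∂φ(Z) − Re(∂̄φ(Z) ē_j²)) − ‖k‖² ∫ u² Re(φ̄(Z) e_j)`
for a real `C¹` lattice-periodic `u` and a `C¹` field `φ` (the flux `u² Im(φ̄(Z) e_j)` is `C¹` and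
lattice periodic, so its derivative along `Pi.single j k` integrates to `0`). [folklore] -/
theorem stein_stepB {L : ℝ} (hL : 0 < L) (m : Fin 3 → ℤ) {φ : ℂ → ℂ} (hφ : ContDiff ℝ 1 φ)
    {u : Config N → ℝ} (hu : ContDiff ℝ 1 u) (hper : IsLatticePeriodic L u) (j : Fin N) :
    ∫ X in cellN N L, 2 * u X * fderiv ℝ u X (Pi.single j (waveVec L m)) *
        (conj (φ (densityMode N L m X)) * cellWave L m (X j)).im =
      (‖waveVec L m‖ ^ 2 * ∫ X in cellN N L, u X ^ 2 *
          (((fderiv ℝ φ (densityMode N L m X) 1 - I * fderiv ℝ φ (densityMode N L m X) I) / 2).re -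
            ((fderiv ℝ φ (densityMode N L m X) 1 + I * fderiv ℝ φ (densityMode N L m X) I) / 2 *
              conj (cellWave L m (X j) ^ 2)).re)) -
        ‖waveVec L m‖ ^ 2 * ∫ X in cellN N L,
          u X ^ 2 * (conj (φ (densityMode N L m X)) * cellWave L m (X j)).re := by
  set κ : ℝ := ‖waveVec L m‖ ^ 2 with hκ
  set d : Config N := Pi.single j (waveVec L m) with hd
  set F : Config N → ℝ := fun Y =>
    (conj (φ (densityMode N L m Y)) * cellWave L m (Y j)).im with hFdef
  set R : Config N → ℝ := fun Y =>
    (conj (φ (densityMode N L m Y)) * cellWave L m (Y j)).re with hRdef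
  set A : Config N → ℝ := fun Y =>
    (((fderiv ℝ φ (densityMode N L m Y) 1 - I * fderiv ℝ φ (densityMode N L m Y) I) / 2).re -
      ((fderiv ℝ φ (densityMode N L m Y) 1 + I * fderiv ℝ φ (densityMode N L m Y) I) / 2 *
        conj (cellWave L m (Y j) ^ 2)).re) with hAdef
  have hF_cd : ContDiff ℝ 1 F := contDiff_steinPhase L m hφ j
  -- the flux `G = u² F` is `C¹` and lattice periodic; its derivative along `d`
  set G : Config N → ℝ := fun Y => u Y * u Y * F Y with hGdef
  have hG_cd : ContDiff ℝ 1 G := (hu.mul hu).mul hF_cd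
  have hG_per : IsLatticePeriodic L G := by
    intro Y i c
    simp only [hGdef, hFdef, hper Y i c, densityMode_periodic hL.ne' m Y i c,
      cellWave_comp_apply_periodic hL.ne' m _ Y i c]
  have hderiv : ∀ X, fderiv ℝ G X d =
      κ * (u X ^ 2 * R X) - κ * (u X ^ 2 * A X) + 2 * u X * fderiv ℝ u X d * F X := by
    intro X
    have hu' : HasFDerivAt u (fderiv ℝ u X) X := (hu.differentiable one_ne_zero X).hasFDerivAt
    have hG' : HasFDerivAt G _ X :=
      (hu'.mul hu').mul (hF_cd.differentiable one_ne_zero X).hasFDerivAt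
    rw [hG'.fderiv]
    simp only [FunLike.coe_add, Pi.add_apply, FunLike.coe_smul, Pi.smul_apply,
      smul_eq_mul, Pi.mul_apply]
    rw [show fderiv ℝ F X d = κ * (R X - A X) by
      rw [hFdef, hd, fderiv_steinPhase_waveVec L m hφ j X]; simp only [hRdef, hAdef]; ring]
    ring
  -- by parts
  have hbp : ∫ X in cellN N L, fderiv ℝ G X d = 0 :=
    integral_cellN_fderiv_single_eq_zero hL hG_cd hG_per j (waveVec L m)
  simp_rw [hderiv] at hbp
  -- integrability of the pieces (everything is continuous on the bounded cell)
  have hφc := hφ.continuous; have hDc := hφ.continuous_fderiv one_ne_zero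
  have hec := (contDiff_cellWave L m).continuous; have hZc := continuous_densityMode N L m
  have huc := hu.continuous; have hduc := hu.continuous_fderiv one_ne_zero
  have hRc : Continuous R := by rw [hRdef]; fun_prop
  have hFc : Continuous F := hF_cd.continuous
  have hAc : Continuous A := by rw [hAdef]; fun_prop
  have hi1 : IntegrableOn (fun X => κ * (u X ^ 2 * R X)) (cellN N L) volume :=
    integrableOn_cellN (by fun_prop) L
  have hi2 : IntegrableOn (fun X => κ * (u X ^ 2 * A X)) (cellN N L) volume :=
    integrableOn_cellN (by fun_prop) L
  have hi3 : IntegrableOn (fun X => 2 * u X * fderiv ℝ u X d * F X) (cellN N L) volume :=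
    integrableOn_cellN (by fun_prop) L
  have hi12 : IntegrableOn (fun X => κ * (u X ^ 2 * R X) - κ * (u X ^ 2 * A X)) (cellN N L) volume :=
    hi1.sub hi2
  rw [integral_add hi12 hi3, integral_sub hi1 hi2, integral_const_mul, integral_const_mul] at hbp
  linarith

/-! ## The Stein identity -/

/-- **The Stein identity** over the named objects of the line (`waveVec`, `densityMode`,
`commutatorAmp`): for a real-valued periodic `C¹` state, every mode `m` and every `C¹` field `φ`,
`Re ∫_{cell^N} φ̄(Z) W Ψ̄ = ‖k‖² Re ∫_{cell^N} (N ∂φ(Z) − ∂̄φ(Z) Z̄⁽²⁾) |Ψ|²`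
(`∂φ = (Dφ·1 − iDφ·i)/2`, `∂̄φ = (Dφ·1 + iDφ·i)/2`, `Z⁽²⁾ = ∑ⱼ eⱼ²`). Proof: with `u = Re Ψ`,
`Re(φ̄(Z) W ū) = ∑ⱼ (‖k‖² u² Re(φ̄(Z)eⱼ) + 2u ∂ⱼu Im(φ̄(Z)eⱼ))`; Step B (`stein_stepB`) per particle;
the `Re(φ̄(Z)eⱼ)` terms cancel. [folklore] -/
theorem steinIdentity_holds (n : ℕ) (L : ℝ) (hL : 0 < L) (Ψ : PeriodicTrialState (n + 1) L)
    (hreal : ∀ X, Ψ.ψ X = (‖Ψ.ψ X‖ : ℂ)) (m : Fin 3 → ℤ) (φ : ℂ → ℂ) (hφ : ContDiff ℝ 1 φ) :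
    (∫ X in cellN (n + 1) L, (conj (φ (densityMode (n + 1) L m X)) *
        commutatorAmp (n + 1) L Ψ.ψ m X * conj (Ψ.ψ X)).re) =
      ‖waveVec L m‖ ^ 2 * ∫ X in cellN (n + 1) L,
        ((((n : ℝ) + 1 : ℝ) : ℂ) *
            ((fderiv ℝ φ (densityMode (n + 1) L m X) 1 -
              I * fderiv ℝ φ (densityMode (n + 1) L m X) I) / 2) -
          (fderiv ℝ φ (densityMode (n + 1) L m X) 1 +
              I * fderiv ℝ φ (densityMode (n + 1) L m X) I) / 2 *
            conj (∑ j : Fin (n + 1), cellWave L m (X j) ^ 2)).re * ‖Ψ.ψ X‖ ^ 2 := by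
  set κ : ℝ := ‖waveVec L m‖ ^ 2 with hκ
  -- the real amplitude `u = Re Ψ = |Ψ|`
  set u : Config (n + 1) → ℝ := fun X => (Ψ.ψ X).re with hudef
  have hψu : ∀ X, Ψ.ψ X = ((u X : ℝ) : ℂ) := fun X => by
    calc Ψ.ψ X = ((‖Ψ.ψ X‖ : ℝ) : ℂ) := hreal X
      _ = ((((‖Ψ.ψ X‖ : ℝ) : ℂ).re : ℝ) : ℂ) := by rw [ofReal_re]
      _ = ((u X : ℝ) : ℂ) := by rw [← hreal X]
  have hu_cd : ContDiff ℝ 1 u := by have h₀ := reCLM.contDiff.comp Ψ.contDiff; exact h₀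
  have hu_per : IsLatticePeriodic L u := fun X i c => congrArg re (Ψ.periodic X i c)
  have hderiv : ∀ X (v : Config (n + 1)), fderiv ℝ Ψ.ψ X v = ((fderiv ℝ u X v : ℝ) : ℂ) := by
    intro X v
    have h₂ : HasFDerivAt Ψ.ψ (ofRealCLM.comp (fderiv ℝ u X)) X := by
      rw [show Ψ.ψ = fun X => ((u X : ℝ) : ℂ) from funext hψu]
      exact ofRealCLM.hasFDerivAt.comp X ((hu_cd.differentiable one_ne_zero) X).hasFDerivAt
    rw [h₂.fderiv, ContinuousLinearMap.comp_apply, ofRealCLM_apply]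
  -- pointwise expansion of the integrand
  set R : Fin (n + 1) → Config (n + 1) → ℝ := fun j X =>
    (conj (φ (densityMode (n + 1) L m X)) * cellWave L m (X j)).re with hRdef
  set F : Fin (n + 1) → Config (n + 1) → ℝ := fun j X =>
    (conj (φ (densityMode (n + 1) L m X)) * cellWave L m (X j)).im with hFdef
  set A : Fin (n + 1) → Config (n + 1) → ℝ := fun j Y =>
    (((fderiv ℝ φ (densityMode (n + 1) L m Y) 1 - I * fderiv ℝ φ (densityMode (n + 1) L m Y) I) / 2).re -
      ((fderiv ℝ φ (densityMode (n + 1) L m Y) 1 + I * fderiv ℝ φ (densityMode (n + 1) L m Y) I) / 2 *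
        conj (cellWave L m (Y j) ^ 2)).re) with hAdef
  set du : Fin (n + 1) → Config (n + 1) → ℝ := fun j X =>
    fderiv ℝ u X (Pi.single j (waveVec L m)) with hdudef
  have hpt : ∀ X, (conj (φ (densityMode (n + 1) L m X)) *
      commutatorAmp (n + 1) L Ψ.ψ m X * conj (Ψ.ψ X)).re =
      ∑ j : Fin (n + 1), (κ * (u X ^ 2 * R j X) + 2 * u X * du j X * F j X) := by
    intro X
    rw [commutatorAmp, Finset.mul_sum, Finset.sum_mul, re_sum]
    refine Finset.sum_congr rfl fun j _ => ?_
    rw [hderiv, hψu X, conj_ofReal]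
    exact re_stein_summand _ _ κ (u X) (du j X)
  simp_rw [hpt]
  -- integrability and Step B per particle
  have hφc := hφ.continuous; have hDc := hφ.continuous_fderiv one_ne_zero
  have hec := (contDiff_cellWave L m).continuous; have hZc := continuous_densityMode (n + 1) L m
  have huc := hu_cd.continuous; have hduc := hu_cd.continuous_fderiv one_ne_zero
  have hRc : ∀ j, Continuous (R j) := fun j => by rw [hRdef]; fun_prop
  have hFc : ∀ j, Continuous (F j) := fun j => by rw [hFdef]; fun_prop
  have hAc : ∀ j, Continuous (A j) := fun j => by rw [hAdef]; fun_prop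
  have hiA : ∀ j, IntegrableOn (fun X => κ * (u X ^ 2 * R j X)) (cellN (n + 1) L) volume :=
    fun j => integrableOn_cellN (by fun_prop) L
  have hiB : ∀ j, IntegrableOn (fun X => 2 * u X * du j X * F j X) (cellN (n + 1) L) volume :=
    fun j => integrableOn_cellN (by rw [hdudef]; fun_prop) L
  have hiC : ∀ j, IntegrableOn (fun X => u X ^ 2 * A j X) (cellN (n + 1) L) volume :=
    fun j => integrableOn_cellN (by fun_prop) L
  have hiAB : ∀ j, IntegrableOn (fun X => κ * (u X ^ 2 * R j X) + 2 * u X * du j X * F j X)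
      (cellN (n + 1) L) volume := fun j => (hiA j).add (hiB j)
  rw [integral_finsetSum _ fun j _ => hiAB j]
  have hstep : ∀ j : Fin (n + 1),
      ∫ X in cellN (n + 1) L, (κ * (u X ^ 2 * R j X) + 2 * u X * du j X * F j X) =
        κ * ∫ X in cellN (n + 1) L, u X ^ 2 * A j X := by
    intro j
    have hB := stein_stepB hL m hφ hu_cd hu_per j
    simp only [hdudef, hFdef, hRdef, hAdef] at hB ⊢
    rw [integral_add (hiA j) (hiB j), integral_const_mul, hB]
    ring
  simp_rw [hstep]
  rw [← Finset.mul_sum, ← integral_finsetSum _ fun j _ => (hiC j)]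
  congr 1
  refine integral_congr_ae (Eventually.of_forall fun X => ?_)
  beta_reduce
  rw [hψu X, norm_real, Real.norm_eq_abs, sq_abs, ← Finset.mul_sum, mul_comm]
  congr 1
  simp only [hAdef]
  rw [Finset.sum_sub_distrib, Finset.sum_const, Finset.card_univ, Fintype.card_fin, nsmul_eq_mul,
    sub_re, re_ofReal_mul, map_sum, Finset.mul_sum, re_sum]
  push_cast
  ring

/-- **Registered stub `stub_steinIdentity`** of crux stmt-AtomisticToContinuum-11784 (line
`fisher-gaussian-density-mode`, lead reshape r1): the Stein / by-parts form of the commutator pairing,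
`Re ∫_{cell^N} φ̄(Z) W Ψ̄ = ‖k‖² Re ∫_{cell^N} (N ∂φ(Z) − ∂̄φ(Z) Z̄⁽²⁾) |Ψ|²`, for a real-valued
(`Ψ = |Ψ|`) periodic `C¹` state on the `N = n+1`-particle torus of side `L > 0`, every mode `m`
(`k = (2π/L)·m`, `eⱼ = e^{ik·xⱼ}`, `Z = ∑ⱼ eⱼ`, `Z⁽²⁾ = ∑ⱼ eⱼ²`, `W = ∑ⱼ eⱼ(‖k‖²Ψ − 2i∂_{xⱼ·k}Ψ)`)
and every real-`C¹` field `φ : ℂ → ℂ` (`∂φ = (Dφ·1 − iDφ·i)/2`, `∂̄φ = (Dφ·1 + iDφ·i)/2`), with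
`k`, `Z`, `W` inline exactly as registered. It is `steinIdentity_holds` (the bodies of `waveVec`,
`densityMode`, `commutatorAmp` are these inline expressions verbatim). [folklore] -/
theorem stub_steinIdentity :
    ∀ (n : ℕ) (L : ℝ), 0 < L → ∀ Ψ : PeriodicTrialState (n + 1) L, (∀ X, Ψ.ψ X = (‖Ψ.ψ X‖ : ℂ)) →
      ∀ (m : Fin 3 → ℤ) (φ : ℂ → ℂ), ContDiff ℝ 1 φ →
        (∫ X in cellN (n + 1) L, (starRingEnd ℂ (φ (∑ j : Fin (n + 1), cellWave L m (X j))) *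
            (∑ j : Fin (n + 1), cellWave L m (X j) *
              (((‖((2 * Real.pi / L) • latticeVec 1 m)‖ ^ 2 : ℝ) : ℂ) * Ψ.ψ X -
                2 * Complex.I * fderiv ℝ Ψ.ψ X (Pi.single j ((2 * Real.pi / L) • latticeVec 1 m)))) *
            starRingEnd ℂ (Ψ.ψ X)).re) =
          ‖((2 * Real.pi / L) • latticeVec 1 m)‖ ^ 2 *
            ∫ X in cellN (n + 1) L,
              ((((n : ℝ) + 1 : ℝ) : ℂ) *
                  ((fderiv ℝ φ (∑ j : Fin (n + 1), cellWave L m (X j)) 1 -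
                      Complex.I * fderiv ℝ φ (∑ j : Fin (n + 1), cellWave L m (X j)) Complex.I) / 2) -
                (fderiv ℝ φ (∑ j : Fin (n + 1), cellWave L m (X j)) 1 +
                      Complex.I * fderiv ℝ φ (∑ j : Fin (n + 1), cellWave L m (X j)) Complex.I) / 2 *
                  starRingEnd ℂ (∑ j : Fin (n + 1), cellWave L m (X j) ^ 2)).re * ‖Ψ.ψ X‖ ^ 2 :=
  fun n L hL Ψ hreal m φ hφ => steinIdentity_holds n L hL Ψ hreal m φ hφ

end ImuSteinIdentity

end Summit.AtomisticToContinuum.BoseEinsteinCondensation.Theorems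

end
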